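import Literature.MathematicalPhysics.QuantumFieldTheory.Balaban1983to89.Node00.OpsYSectDCoords
import Literature.MathematicalPhysics.QuantumFieldTheory.Balaban1983to89.Node00.OpsYRecordV4P
import Literature.MathematicalPhysics.QuantumFieldTheory.Balaban1983to89.B9BackgroundsKLevelV1R
import Literature.MathematicalPhysics.QuantumFieldTheory.Balaban1983to89.B9Thm312Whole
import Literature.MathematicalPhysics.QuantumFieldTheory.Balaban1983to89.B9CoReadingCoordsS

/-!
# `Balaban1983to89.Node00.OpsYOps312OfRecord` — T. Bałaban, *Propagators for lattice gauge theories in a background field*, Commun. Math. Phys. **99**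
# (1985) 389–434 [Balaban1985BackgroundPropagators], Sect. D, Theorems 3.12–3.13 pp. 419–426: THE SECT.-D OPERATOR RECORD `𝔬12` OF STAGE 3′(Y) IN THE
# CLASS-PARAMETRIC (`R`-) TYPING OF THE CERTIFICATE OF RECORD — `ops312YOfRecord`, its twenty-two field faces, and `pins312_of_eq`

statement-level skeleton of published theorems with citation tags; proofs where landed; nothing here is a claim about the Yang–Mills mass gap

THE PRINT.  Sect. D (pp. 419–426) works with a fixed list of operators depending on the background configuration `U`: `G₀ = (Δ + DRD* + Q*aQ)⁻¹`
(p. 421; Theorem 3.3's `G`), `Δ_a = G₀⁻¹` (Theorem 3.11 p. 416), `Δ′_π` ((3.120)–(3.121) p. 420), `Δ⁽²⁾_π` ((3.135) p. 422), `G = (Δ_π + DRD* + Q*aQ)⁻¹`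
((3.122) p. 420), `G₁` ((3.128) p. 421), `𝔊` ((3.148)∕(3.153) pp. 425–426), `∇_U ∕ ∇*_U` ((3.42) p. 397), the averaging operator `Q` and its adjoint
`Q*` ((3.13) p. 393, (3.110) p. 418), `C = (QGQ*)⁻¹ ∕ C₁ = (QG₁Q*)⁻¹` ((3.123) p. 420, (3.132) p. 422), `H ∕ H₁` ((3.126) p. 420, (3.129) p. 421), and the
`D ∕ D* ∕ R` of `DRD*` ((3.6)–(3.8) pp. 391–392, (3.25) p. 394, (3.124) p. 420).  Theorem 3.12 (p. 423) and Theorem 3.13 (p. 426) are statements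
about THESE operators; in the N06 certificate they are the twenty-two fields of n06-d's parameter record `B9Thm312Whole.Ops` («a PARAMETER RECORD —
nothing is constructed or asserted»), one record per family member, typed over four real coordinate lattices `X Y Z W`.

WHY THIS FILE (pub-ymgap bus 2026-08-29, node00-def-Y g28 INTENT-72; dag-n06-d g20 QUESTION-56 word «YES: please file `Node00/OpsYOps312OfRecord`
R-typed like V2 … with the 22 right-hand sides of UF's `hblk12 … hRco12` + `pins312_of_eq (h𝔬12 : 𝔬12 = …) : 22 conjuncts` in EXACTLY UF's binder
texts; I fold it as `h𝔬12` (−22 +1) in the NEXT edition»).  The certificate of record (`Summit.….N06AtOpsYNuOfRecordV6EPairUD ∕ …UF`) binds the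
Sect.-D operator family as a PARAMETER `𝔬12 : ∀ x, B9Thm312Whole.Ops (geo9Y x) (bg9YR … R₁ R₂ x) (XBK (TrIdx N) x.toKIdx) (XBK (TrIdx N) x.toKIdx)
(XHK (TrIdx N) x.toKIdx) (XSK (TrIdx N) x.toKIdx)` — the class-parametric background carrier `bg9YR` of `B9BackgroundsKLevelV1R`, n06-d's coordinate
carriers `XBK ∕ XHK ∕ XSK` over the trace-orthonormal basis index `TrIdx N` — and DISPLAYS TWENTY-TWO PINS `hblk12 … hRco12` tying its fields to the
seats' coordinate readers AT def-Y's LETTERS OF RECORD: the block maps `blkBK ∕ blkSK ∘ sIK ∕ blkHK` through the certificate's block map `bI`; `GcoK` of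
the letters `GA ∕ GD ∕ G₁ ∕ GG` and `HcoK` of `H ∕ H₁` of `lettersYOfRecordV4P N θ M⋆ 𝔯` (`Node00.OpsYRecordV4P`); `DcoK ∕ DscoK`; and the ten Sect.-D
models `S0coK ∕ TpicoK ∕ T2coK ∕ QcoKH ∕ QscoKH ∕ CcoK ∕ C1coK ∕ DvcoKH ∕ DvscoKH ∕ RcoK` of `Node00.OpsYSectDCoords` §5 at the record's transporters
`parSymY ∕ parBY`, the gauge-fixed site operator `GpPhysY … (parSymY …)` and the residual letter `(𝔯 x).Δ2`.  This file defines the record whose fields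
ARE those right-hand sides, so that the edition after may instantiate `𝔬12 := ops312YOfRecord …` (the twenty-two pins then close by `rfl` — §2) or
keep `𝔬12` bound with ONE equation `h𝔬12 : 𝔬12 = ops312YOfRecord N θ M⋆ 𝔯 R₁ R₂ bI` (§2 `pins312_of_eq` recovers the twenty-two named hypotheses in
exactly their displayed shapes and order).

WHAT THIS FILE DOES (one definition by field assignment + `rfl` faces; record-level knit file — it imports the N06 seats' coordinate-reader modules;
nothing in NODE 00's letter layer imports it; `Node00.OpsYExpsOfRecordV2` is neither imported nor touched):
* §1 ★★ `ops312YOfRecord N θ M⋆ 𝔯 R₁ R₂ bI x : B9Thm312Whole.Ops (geo9Y x) (bg9YR (Matrix (Fin N) (Fin N) ℂ) (specialUnitaryUnits (Fin N)) R₁ R₂ x)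
  (XBK (TrIdx N) x.toKIdx) (XBK (TrIdx N) x.toKIdx) (XHK (TrIdx N) x.toKIdx) (XSK (TrIdx N) x.toKIdx)` — the member `x` is the LAST binder, so the
  partial application `ops312YOfRecord N θ M⋆ 𝔯 R₁ R₂ bI` has exactly the type of the certificate's binder `𝔬12`; the twenty-two fields are the
  certificate's right-hand sides VERBATIM (configuration map `fun U => U`: the carrier's configurations ARE def-Y's `CfgY`).
* §2 the twenty-two field lemmas (`ops312YOfRecord_blk`, …, `ops312YOfRecord_R`, all `rfl`) and ★★★ `pins312_of_eq : 𝔬12 = ops312YOfRecord … →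
  ⟨hblk12, hblkW12, hblkY12, hG0co12, hGco12, hG1co12, hGGco12, hDco12, hDsco12, hblkZ12, hHm12, hH1m12, hS0co12, hTpico12, hT2co12, hQco12, hQsco12,
  hCco12, hC1co12, hDvco12, hDvsco12, hRco12⟩` — the conjunction of the twenty-two pins in the certificate's binder texts and ORDER (with the
  certificate's `θ.toStage3Params` read as this file's `θ : Stage3Params`).

HONEST SCOPE.  Definitional packaging of the seats' own coordinate readers at def-Y's letters of record and `rfl` transport; no inverse is
constructed here beyond what the readers already are, and no identity, inequality, expansion or positivity statement of the paper is proved or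
asserted (Theorem 3.12's conclusions stay the certificate's `HasRWExp ∕ HasRWExpH ∕ PosDefK` letters and rows; the `Identities` hypotheses of the knit
stay where `Node00.OpsYSectDCoords` §6–§7 and the located gap O5 leave them); the regularity classes `R₁ R₂`, the block map `bI` and the residual
family `𝔯` stay the certificate's binders.  Nothing landed is modified; count-neutral; N06 is NOT discharged; one finite lattice programme at fixed
ε; NOT continuum, NOT ℝ⁴, NOT OS, NOT the mass gap, NOT Clay.  Filed by the pub-ymgap def-Y owner lineage (`pub-ymgap-node00-def-Y` g28), cell
`pub-ymgap` (D-0062), node N06 [B9] at NODE 00's instance, 2026-08-29.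
-/

noncomputable section

namespace Literature.MathematicalPhysics.QuantumFieldTheory.Balaban1983to89.Node00.OpsYOps312OfRecord

open Node00
open B9PinMembersKLevelV1 (MemberY geo9Y)
open B9BackgroundsKLevelV1R (RegFamY bg9YR)
open B7Prop2SpecialUnitary (specialUnitaryUnits)
open B9CoReadingCoordsTranspose (TrIdx trBasis)
open B9CoReadingCoords (XBK blkBK GcoK DcoK DscoK)
open B9CoReadingCoordsS (XSK blkSK sIK)
open B9CoReadingCoordsH (XHK blkHK HcoK)
open Literature.MathematicalPhysics.QuantumFieldTheory.Balaban1983to89.Node00.OpsYSectDCoords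
  (S0coK TpicoK T2coK QcoKH QscoKH CcoK C1coK DvcoKH DvscoKH RcoK)
open scoped Matrix.Norms.L2Operator

/-! ## §1 The Sect.-D operator record of Stage 3′(Y) in the class-parametric typing -/

section Record

variable (N : ℕ) (θ : Stage3Params) (Mstar : ℕ) (𝔯 : ResY N θ Mstar)
  (R₁ R₂ : RegFamY θ.d₆ θ.ℓ₆ θ.hd' θ.hL' θ.b₀ θ.b₁ Mstar (Matrix (Fin N) (Fin N) ℂ))
  (bI : ∀ x : MemberY θ.d₆ θ.ℓ₆ θ.hd' θ.hL' θ.b₀ θ.b₁ Mstar, FBondY x.toKIdx → IBondY x.toKIdx)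

/-- ★★ **THE SECT.-D OPERATOR RECORD OF STAGE 3′(Y)** at the member `x`, over the class-parametric background carrier `bg9YR … R₁ R₂ x` and n06-d's
coordinate carriers `XBK ∕ XBK ∕ XHK ∕ XSK` at the basis index `TrIdx N`: the block maps `blkBK (bI x) ∕ blkBK (bI x) ∕ blkHK ∕ blkSK (sIK (bI x))`;
`G₀ ∕ G ∕ G₁ ∕ 𝔊` = `GcoK` of the letters `GA ∕ GD ∕ G₁ ∕ GG` of record, `H ∕ H₁` = `HcoK` of the letters `H ∕ H₁` of record, `∇_U ∕ ∇*_U` = `DcoK ∕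
DscoK`, and `Δ_a ∕ Δ′_π ∕ Δ⁽²⁾_π ∕ Q ∕ Q* ∕ C ∕ C₁ ∕ D ∕ D* ∕ R` = the Sect.-D models `S0coK ∕ TpicoK ∕ T2coK ∕ QcoKH ∕ QscoKH ∕ CcoK ∕ C1coK ∕ DvcoKH ∕
DvscoKH ∕ RcoK` at the transporters of record `parSymY ∕ parBY`, the site operator `GpPhysY … (parSymY …)` and the residual letter `(𝔯 x).Δ2` — each
field the right-hand side of the corresponding pin `hblk12 … hRco12` of the N06 certificate of record, verbatim.  A parameter record by field
assignment; nothing of [B9] is asserted.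
[cite: Balaban1985BackgroundPropagators, Thm 3.12 p.423, Thm 3.13 p.426, (3.120)–(3.153) pp.419–426, (3.13) p.393, (3.25) p.394, (3.42) p.397] -/
def ops312YOfRecord (x : MemberY θ.d₆ θ.ℓ₆ θ.hd' θ.hL' θ.b₀ θ.b₁ Mstar) :
    B9Thm312Whole.Ops (geo9Y x) (bg9YR (Matrix (Fin N) (Fin N) ℂ) (specialUnitaryUnits (Fin N)) R₁ R₂ x)
      (XBK (TrIdx N) x.toKIdx) (XBK (TrIdx N) x.toKIdx) (XHK (TrIdx N) x.toKIdx) (XSK (TrIdx N) x.toKIdx) where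
  blk := blkBK x.toKIdx (bI x)
  blkY := blkBK x.toKIdx (bI x)
  blkZ := blkHK x.toKIdx
  blkW := blkSK x.toKIdx (sIK x.toKIdx (bI x))
  G0 := fun U =>
    GcoK x.toKIdx (trBasis N) (bg9YR (Matrix (Fin N) (Fin N) ℂ) (specialUnitaryUnits (Fin N)) R₁ R₂ x) (fun U => U)
      (lettersYOfRecordV4P N θ Mstar 𝔯 x).GA U
  S0 := fun U =>
    S0coK x.toKIdx (trBasis N) (bg9YR (Matrix (Fin N) (Fin N) ℂ) (specialUnitaryUnits (Fin N)) R₁ R₂ x) (fun U => U) (parSymY x.toKIdx)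
      (parBY x.toKIdx) (GpPhysY x.toKIdx (parSymY x.toKIdx)) U
  Tpi := fun U =>
    TpicoK x.toKIdx (trBasis N) (bg9YR (Matrix (Fin N) (Fin N) ℂ) (specialUnitaryUnits (Fin N)) R₁ R₂ x) (fun U => U) (parSymY x.toKIdx)
      (GpPhysY x.toKIdx (parSymY x.toKIdx)) U
  T2 := fun U =>
    T2coK x.toKIdx (trBasis N) (bg9YR (Matrix (Fin N) (Fin N) ℂ) (specialUnitaryUnits (Fin N)) R₁ R₂ x) (fun U => U) (parSymY x.toKIdx)
      (GpPhysY x.toKIdx (parSymY x.toKIdx)) (𝔯 x).Δ2 U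
  G := fun U =>
    GcoK x.toKIdx (trBasis N) (bg9YR (Matrix (Fin N) (Fin N) ℂ) (specialUnitaryUnits (Fin N)) R₁ R₂ x) (fun U => U)
      (lettersYOfRecordV4P N θ Mstar 𝔯 x).GD U
  G1 := fun U =>
    GcoK x.toKIdx (trBasis N) (bg9YR (Matrix (Fin N) (Fin N) ℂ) (specialUnitaryUnits (Fin N)) R₁ R₂ x) (fun U => U)
      (lettersYOfRecordV4P N θ Mstar 𝔯 x).G₁ U
  GG := fun U =>
    GcoK x.toKIdx (trBasis N) (bg9YR (Matrix (Fin N) (Fin N) ℂ) (specialUnitaryUnits (Fin N)) R₁ R₂ x) (fun U => U)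
      (lettersYOfRecordV4P N θ Mstar 𝔯 x).GG U
  D := fun U => DcoK x.toKIdx (trBasis N) (bg9YR (Matrix (Fin N) (Fin N) ℂ) (specialUnitaryUnits (Fin N)) R₁ R₂ x) (fun U => U) U
  Dstar := fun U => DscoK x.toKIdx (trBasis N) (bg9YR (Matrix (Fin N) (Fin N) ℂ) (specialUnitaryUnits (Fin N)) R₁ R₂ x) (fun U => U) U
  Q := fun U =>
    QcoKH x.toKIdx (trBasis N) (bg9YR (Matrix (Fin N) (Fin N) ℂ) (specialUnitaryUnits (Fin N)) R₁ R₂ x) (fun U => U) (parBY x.toKIdx) U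
  Qstar := fun U =>
    QscoKH x.toKIdx (trBasis N) (bg9YR (Matrix (Fin N) (Fin N) ℂ) (specialUnitaryUnits (Fin N)) R₁ R₂ x) (fun U => U) (parBY x.toKIdx) U
  C := fun U =>
    CcoK x.toKIdx (trBasis N) (bg9YR (Matrix (Fin N) (Fin N) ℂ) (specialUnitaryUnits (Fin N)) R₁ R₂ x) (fun U => U) (parSymY x.toKIdx)
      (parBY x.toKIdx) (GpPhysY x.toKIdx (parSymY x.toKIdx)) U
  C1 := fun U =>
    C1coK x.toKIdx (trBasis N) (bg9YR (Matrix (Fin N) (Fin N) ℂ) (specialUnitaryUnits (Fin N)) R₁ R₂ x) (fun U => U) (parSymY x.toKIdx)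
      (parBY x.toKIdx) (GpPhysY x.toKIdx (parSymY x.toKIdx)) (𝔯 x).Δ2 U
  Hm := fun U =>
    HcoK x.toKIdx (trBasis N) (bg9YR (Matrix (Fin N) (Fin N) ℂ) (specialUnitaryUnits (Fin N)) R₁ R₂ x) (fun U => U)
      (lettersYOfRecordV4P N θ Mstar 𝔯 x).H U
  H1m := fun U =>
    HcoK x.toKIdx (trBasis N) (bg9YR (Matrix (Fin N) (Fin N) ℂ) (specialUnitaryUnits (Fin N)) R₁ R₂ x) (fun U => U)
      (lettersYOfRecordV4P N θ Mstar 𝔯 x).H₁ U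
  Dv := fun U => DvcoKH x.toKIdx (trBasis N) (bg9YR (Matrix (Fin N) (Fin N) ℂ) (specialUnitaryUnits (Fin N)) R₁ R₂ x) (fun U => U) U
  Dvstar := fun U => DvscoKH x.toKIdx (trBasis N) (bg9YR (Matrix (Fin N) (Fin N) ℂ) (specialUnitaryUnits (Fin N)) R₁ R₂ x) (fun U => U) U
  R := fun U =>
    RcoK x.toKIdx (trBasis N) (bg9YR (Matrix (Fin N) (Fin N) ℂ) (specialUnitaryUnits (Fin N)) R₁ R₂ x) (fun U => U) (parSymY x.toKIdx)
      (GpPhysY x.toKIdx (parSymY x.toKIdx)) U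

end Record

/-! ## §2 The twenty-two faces of the record, field by field and bundled (`pins312_of_eq`), in the certificate's binder shapes -/

section Faces

variable (N : ℕ) (θ : Stage3Params) (Mstar : ℕ) (𝔯 : ResY N θ Mstar)
  (R₁ R₂ : RegFamY θ.d₆ θ.ℓ₆ θ.hd' θ.hL' θ.b₀ θ.b₁ Mstar (Matrix (Fin N) (Fin N) ℂ))
  (bI : ∀ x : MemberY θ.d₆ θ.ℓ₆ θ.hd' θ.hL' θ.b₀ θ.b₁ Mstar, FBondY x.toKIdx → IBondY x.toKIdx)
  (x : MemberY θ.d₆ θ.ℓ₆ θ.hd' θ.hL' θ.b₀ θ.b₁ Mstar)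

/-- face `blk` (pin `hblk12`). [cite: Balaban1985BackgroundPropagators, (3.120)–(3.153) pp.419–426, bookkeeping] -/
theorem ops312YOfRecord_blk : (ops312YOfRecord N θ Mstar 𝔯 R₁ R₂ bI x).blk = blkBK x.toKIdx (bI x) := by
  dsimp only [ops312YOfRecord]

/-- face `blkW` (pin `hblkW12`). [cite: Balaban1985BackgroundPropagators, (3.120)–(3.153) pp.419–426, bookkeeping] -/
theorem ops312YOfRecord_blkW : (ops312YOfRecord N θ Mstar 𝔯 R₁ R₂ bI x).blkW = blkSK x.toKIdx (sIK x.toKIdx (bI x)) := by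
  dsimp only [ops312YOfRecord]

/-- face `blkY` (pin `hblkY12`). [cite: Balaban1985BackgroundPropagators, (3.120)–(3.153) pp.419–426, bookkeeping] -/
theorem ops312YOfRecord_blkY : (ops312YOfRecord N θ Mstar 𝔯 R₁ R₂ bI x).blkY = blkBK x.toKIdx (bI x) := by
  dsimp only [ops312YOfRecord]

/-- face `G0` = `GcoK` of the letter `GA` of record (pin `hG0co12`). [cite: Balaban1985BackgroundPropagators, p.421 («G₀»), (3.42) p.397] -/
theorem ops312YOfRecord_G0 (U : (bg9YR (Matrix (Fin N) (Fin N) ℂ) (specialUnitaryUnits (Fin N)) R₁ R₂ x).Cfg) :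
    (ops312YOfRecord N θ Mstar 𝔯 R₁ R₂ bI x).G0 U = GcoK x.toKIdx (trBasis N) (bg9YR (Matrix (Fin N) (Fin N) ℂ) (specialUnitaryUnits (Fin N)) R₁ R₂ x)
      (fun U => U) (lettersYOfRecordV4P N θ Mstar 𝔯 x).GA U := by
  dsimp only [ops312YOfRecord]

/-- face `G` = `GcoK` of the letter `GD` of record (pin `hGco12`). [cite: Balaban1985BackgroundPropagators, (3.122) p.420] -/
theorem ops312YOfRecord_G (U : (bg9YR (Matrix (Fin N) (Fin N) ℂ) (specialUnitaryUnits (Fin N)) R₁ R₂ x).Cfg) :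
    (ops312YOfRecord N θ Mstar 𝔯 R₁ R₂ bI x).G U = GcoK x.toKIdx (trBasis N) (bg9YR (Matrix (Fin N) (Fin N) ℂ) (specialUnitaryUnits (Fin N)) R₁ R₂ x)
      (fun U => U) (lettersYOfRecordV4P N θ Mstar 𝔯 x).GD U := by
  dsimp only [ops312YOfRecord]

/-- face `G1` = `GcoK` of the letter `G₁` of record (pin `hG1co12`). [cite: Balaban1985BackgroundPropagators, (3.128) p.421] -/
theorem ops312YOfRecord_G1 (U : (bg9YR (Matrix (Fin N) (Fin N) ℂ) (specialUnitaryUnits (Fin N)) R₁ R₂ x).Cfg) :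
    (ops312YOfRecord N θ Mstar 𝔯 R₁ R₂ bI x).G1 U = GcoK x.toKIdx (trBasis N) (bg9YR (Matrix (Fin N) (Fin N) ℂ) (specialUnitaryUnits (Fin N)) R₁ R₂ x)
      (fun U => U) (lettersYOfRecordV4P N θ Mstar 𝔯 x).G₁ U := by
  dsimp only [ops312YOfRecord]

/-- face `GG` = `GcoK` of the letter `GG` (`𝔊`) of record (pin `hGGco12`). [cite: Balaban1985BackgroundPropagators, (3.148) p.425, (3.153) p.426] -/
theorem ops312YOfRecord_GG (U : (bg9YR (Matrix (Fin N) (Fin N) ℂ) (specialUnitaryUnits (Fin N)) R₁ R₂ x).Cfg) :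
    (ops312YOfRecord N θ Mstar 𝔯 R₁ R₂ bI x).GG U = GcoK x.toKIdx (trBasis N) (bg9YR (Matrix (Fin N) (Fin N) ℂ) (specialUnitaryUnits (Fin N)) R₁ R₂ x)
      (fun U => U) (lettersYOfRecordV4P N θ Mstar 𝔯 x).GG U := by
  dsimp only [ops312YOfRecord]

/-- face `D` = `DcoK` (pin `hDco12`). [cite: Balaban1985BackgroundPropagators, (3.42) p.397 («∇_U G(U)»)] -/
theorem ops312YOfRecord_D (U : (bg9YR (Matrix (Fin N) (Fin N) ℂ) (specialUnitaryUnits (Fin N)) R₁ R₂ x).Cfg) :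
    (ops312YOfRecord N θ Mstar 𝔯 R₁ R₂ bI x).D U =
      DcoK x.toKIdx (trBasis N) (bg9YR (Matrix (Fin N) (Fin N) ℂ) (specialUnitaryUnits (Fin N)) R₁ R₂ x) (fun U => U) U := by
  dsimp only [ops312YOfRecord]

/-- face `Dstar` = `DscoK` (pin `hDsco12`). [cite: Balaban1985BackgroundPropagators, (3.42) p.397 («G(U)∇*_U»)] -/
theorem ops312YOfRecord_Dstar (U : (bg9YR (Matrix (Fin N) (Fin N) ℂ) (specialUnitaryUnits (Fin N)) R₁ R₂ x).Cfg) :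
    (ops312YOfRecord N θ Mstar 𝔯 R₁ R₂ bI x).Dstar U =
      DscoK x.toKIdx (trBasis N) (bg9YR (Matrix (Fin N) (Fin N) ℂ) (specialUnitaryUnits (Fin N)) R₁ R₂ x) (fun U => U) U := by
  dsimp only [ops312YOfRecord]

/-- face `blkZ` (pin `hblkZ12`). [cite: Balaban1985BackgroundPropagators, (3.120)–(3.153) pp.419–426, bookkeeping] -/
theorem ops312YOfRecord_blkZ : (ops312YOfRecord N θ Mstar 𝔯 R₁ R₂ bI x).blkZ = blkHK x.toKIdx := by
  dsimp only [ops312YOfRecord]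

/-- face `Hm` = `HcoK` of the letter `H` of record (pin `hHm12`). [cite: Balaban1985BackgroundPropagators, (3.126) p.420] -/
theorem ops312YOfRecord_Hm (U : (bg9YR (Matrix (Fin N) (Fin N) ℂ) (specialUnitaryUnits (Fin N)) R₁ R₂ x).Cfg) :
    (ops312YOfRecord N θ Mstar 𝔯 R₁ R₂ bI x).Hm U = HcoK x.toKIdx (trBasis N) (bg9YR (Matrix (Fin N) (Fin N) ℂ) (specialUnitaryUnits (Fin N)) R₁ R₂ x)
      (fun U => U) (lettersYOfRecordV4P N θ Mstar 𝔯 x).H U := by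
  dsimp only [ops312YOfRecord]

/-- face `H1m` = `HcoK` of the letter `H₁` of record (pin `hH1m12`). [cite: Balaban1985BackgroundPropagators, (3.129) p.421] -/
theorem ops312YOfRecord_H1m (U : (bg9YR (Matrix (Fin N) (Fin N) ℂ) (specialUnitaryUnits (Fin N)) R₁ R₂ x).Cfg) :
    (ops312YOfRecord N θ Mstar 𝔯 R₁ R₂ bI x).H1m U = HcoK x.toKIdx (trBasis N) (bg9YR (Matrix (Fin N) (Fin N) ℂ) (specialUnitaryUnits (Fin N)) R₁ R₂ x)
      (fun U => U) (lettersYOfRecordV4P N θ Mstar 𝔯 x).H₁ U := by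
  dsimp only [ops312YOfRecord]

/-- face `S0` = `S0coK` at the record (pin `hS0co12`). [cite: Balaban1985BackgroundPropagators, (3.26) p.395, p.421 («G₀»), Thm 3.11 p.416] -/
theorem ops312YOfRecord_S0 (U : (bg9YR (Matrix (Fin N) (Fin N) ℂ) (specialUnitaryUnits (Fin N)) R₁ R₂ x).Cfg) :
    (ops312YOfRecord N θ Mstar 𝔯 R₁ R₂ bI x).S0 U = S0coK x.toKIdx (trBasis N) (bg9YR (Matrix (Fin N) (Fin N) ℂ) (specialUnitaryUnits (Fin N)) R₁ R₂ x)
      (fun U => U) (parSymY x.toKIdx) (parBY x.toKIdx) (GpPhysY x.toKIdx (parSymY x.toKIdx)) U := by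
  dsimp only [ops312YOfRecord]

/-- face `Tpi` = `TpicoK` at the record (pin `hTpico12`). [cite: Balaban1985BackgroundPropagators, (3.121) p.420] -/
theorem ops312YOfRecord_Tpi (U : (bg9YR (Matrix (Fin N) (Fin N) ℂ) (specialUnitaryUnits (Fin N)) R₁ R₂ x).Cfg) :
    (ops312YOfRecord N θ Mstar 𝔯 R₁ R₂ bI x).Tpi U = TpicoK x.toKIdx (trBasis N) (bg9YR (Matrix (Fin N) (Fin N) ℂ) (specialUnitaryUnits (Fin N)) R₁ R₂ x)
      (fun U => U) (parSymY x.toKIdx) (GpPhysY x.toKIdx (parSymY x.toKIdx)) U := by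
  dsimp only [ops312YOfRecord]

/-- face `T2` = `T2coK` at the record and the residual letter `(𝔯 x).Δ2` (pin `hT2co12`). [cite: Balaban1985BackgroundPropagators, (3.135) p.422] -/
theorem ops312YOfRecord_T2 (U : (bg9YR (Matrix (Fin N) (Fin N) ℂ) (specialUnitaryUnits (Fin N)) R₁ R₂ x).Cfg) :
    (ops312YOfRecord N θ Mstar 𝔯 R₁ R₂ bI x).T2 U = T2coK x.toKIdx (trBasis N) (bg9YR (Matrix (Fin N) (Fin N) ℂ) (specialUnitaryUnits (Fin N)) R₁ R₂ x)
      (fun U => U) (parSymY x.toKIdx) (GpPhysY x.toKIdx (parSymY x.toKIdx)) (𝔯 x).Δ2 U := by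
  dsimp only [ops312YOfRecord]

/-- face `Q` = `QcoKH` at the bond transporter of record (pin `hQco12`). [cite: Balaban1985BackgroundPropagators, (3.13) p.393, (3.35) p.396, (3.110) p.418] -/
theorem ops312YOfRecord_Q (U : (bg9YR (Matrix (Fin N) (Fin N) ℂ) (specialUnitaryUnits (Fin N)) R₁ R₂ x).Cfg) :
    (ops312YOfRecord N θ Mstar 𝔯 R₁ R₂ bI x).Q U = QcoKH x.toKIdx (trBasis N) (bg9YR (Matrix (Fin N) (Fin N) ℂ) (specialUnitaryUnits (Fin N)) R₁ R₂ x)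
      (fun U => U) (parBY x.toKIdx) U := by
  dsimp only [ops312YOfRecord]

/-- face `Qstar` = `QscoKH` at the bond transporter of record (pin `hQsco12`). [cite: Balaban1985BackgroundPropagators, (3.13) p.393 (Q* the adjoint of Q)] -/
theorem ops312YOfRecord_Qstar (U : (bg9YR (Matrix (Fin N) (Fin N) ℂ) (specialUnitaryUnits (Fin N)) R₁ R₂ x).Cfg) :
    (ops312YOfRecord N θ Mstar 𝔯 R₁ R₂ bI x).Qstar U = QscoKH x.toKIdx (trBasis N) (bg9YR (Matrix (Fin N) (Fin N) ℂ) (specialUnitaryUnits (Fin N)) R₁ R₂ x)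
      (fun U => U) (parBY x.toKIdx) U := by
  dsimp only [ops312YOfRecord]

/-- face `C` = `CcoK` at the record (pin `hCco12`). [cite: Balaban1985BackgroundPropagators, (3.123) p.420, (3.132) p.422] -/
theorem ops312YOfRecord_C (U : (bg9YR (Matrix (Fin N) (Fin N) ℂ) (specialUnitaryUnits (Fin N)) R₁ R₂ x).Cfg) :
    (ops312YOfRecord N θ Mstar 𝔯 R₁ R₂ bI x).C U = CcoK x.toKIdx (trBasis N) (bg9YR (Matrix (Fin N) (Fin N) ℂ) (specialUnitaryUnits (Fin N)) R₁ R₂ x)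
      (fun U => U) (parSymY x.toKIdx) (parBY x.toKIdx) (GpPhysY x.toKIdx (parSymY x.toKIdx)) U := by
  dsimp only [ops312YOfRecord]

/-- face `C1` = `C1coK` at the record and the residual letter `(𝔯 x).Δ2` (pin `hC1co12`). [cite: Balaban1985BackgroundPropagators, (3.132) p.422] -/
theorem ops312YOfRecord_C1 (U : (bg9YR (Matrix (Fin N) (Fin N) ℂ) (specialUnitaryUnits (Fin N)) R₁ R₂ x).Cfg) :
    (ops312YOfRecord N θ Mstar 𝔯 R₁ R₂ bI x).C1 U = C1coK x.toKIdx (trBasis N) (bg9YR (Matrix (Fin N) (Fin N) ℂ) (specialUnitaryUnits (Fin N)) R₁ R₂ x)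
      (fun U => U) (parSymY x.toKIdx) (parBY x.toKIdx) (GpPhysY x.toKIdx (parSymY x.toKIdx)) (𝔯 x).Δ2 U := by
  dsimp only [ops312YOfRecord]

/-- face `Dv` = `DvcoKH` (pin `hDvco12`). [cite: Balaban1985BackgroundPropagators, (3.6) p.391, (3.124) p.420] -/
theorem ops312YOfRecord_Dv (U : (bg9YR (Matrix (Fin N) (Fin N) ℂ) (specialUnitaryUnits (Fin N)) R₁ R₂ x).Cfg) :
    (ops312YOfRecord N θ Mstar 𝔯 R₁ R₂ bI x).Dv U =
      DvcoKH x.toKIdx (trBasis N) (bg9YR (Matrix (Fin N) (Fin N) ℂ) (specialUnitaryUnits (Fin N)) R₁ R₂ x) (fun U => U) U := by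
  dsimp only [ops312YOfRecord]

/-- face `Dvstar` = `DvscoKH` (pin `hDvsco12`). [cite: Balaban1985BackgroundPropagators, (3.8) p.392, (3.124) p.420] -/
theorem ops312YOfRecord_Dvstar (U : (bg9YR (Matrix (Fin N) (Fin N) ℂ) (specialUnitaryUnits (Fin N)) R₁ R₂ x).Cfg) :
    (ops312YOfRecord N θ Mstar 𝔯 R₁ R₂ bI x).Dvstar U =
      DvscoKH x.toKIdx (trBasis N) (bg9YR (Matrix (Fin N) (Fin N) ℂ) (specialUnitaryUnits (Fin N)) R₁ R₂ x) (fun U => U) U := by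
  dsimp only [ops312YOfRecord]

/-- face `R` = `RcoK` at the record (pin `hRco12`). [cite: Balaban1985BackgroundPropagators, (3.25) p.394, Thm 3.11 p.416] -/
theorem ops312YOfRecord_R (U : (bg9YR (Matrix (Fin N) (Fin N) ℂ) (specialUnitaryUnits (Fin N)) R₁ R₂ x).Cfg) :
    (ops312YOfRecord N θ Mstar 𝔯 R₁ R₂ bI x).R U = RcoK x.toKIdx (trBasis N) (bg9YR (Matrix (Fin N) (Fin N) ℂ) (specialUnitaryUnits (Fin N)) R₁ R₂ x)
      (fun U => U) (parSymY x.toKIdx) (GpPhysY x.toKIdx (parSymY x.toKIdx)) U := by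
  dsimp only [ops312YOfRecord]

end Faces

section Pins

variable {N : ℕ} {θ : Stage3Params} {Mstar : ℕ} {𝔯 : ResY N θ Mstar}
  {R₁ R₂ : RegFamY θ.d₆ θ.ℓ₆ θ.hd' θ.hL' θ.b₀ θ.b₁ Mstar (Matrix (Fin N) (Fin N) ℂ)}
  {bI : ∀ x : MemberY θ.d₆ θ.ℓ₆ θ.hd' θ.hL' θ.b₀ θ.b₁ Mstar, FBondY x.toKIdx → IBondY x.toKIdx}

/-- ★★★ **THE TWENTY-TWO PINS FROM ONE EQUATION**: if the certificate's Sect.-D operator family `𝔬12` IS the record, `𝔬12 = ops312YOfRecord N θ M⋆ 𝔯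
R₁ R₂ bI`, then the twenty-two displayed hypotheses `hblk12, hblkW12, hblkY12, hG0co12, hGco12, hG1co12, hGGco12, hDco12, hDsco12, hblkZ12, hHm12,
hH1m12, hS0co12, hTpico12, hT2co12, hQco12, hQsco12, hCco12, hC1co12, hDvco12, hDvsco12, hRco12` of the N06 certificate of record hold, stated in
exactly their displayed shapes and in that order; every parameter is implicit (read off `h𝔬12`).  Usage: `obtain ⟨hblk12, …, hRco12⟩ :=
OpsYOps312OfRecord.pins312_of_eq h𝔬12`; at the instantiated record, `pins312_of_eq rfl` (or the field lemmas above) — NOT bare `rfl` pin by pin: lazy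
delta-reduction unfolds the reader (`TpicoK …`) before projecting the record and overruns the default `maxRecDepth` on the `Tpi` pin, whereas the
field lemmas project first (`dsimp only [ops312YOfRecord]`).
[cite: Balaban1985BackgroundPropagators, Thm 3.12 p.423, Thm 3.13 p.426, (3.120)–(3.153) pp.419–426, bookkeeping] -/
theorem pins312_of_eq
    {𝔬12 : ∀ x : MemberY θ.d₆ θ.ℓ₆ θ.hd' θ.hL' θ.b₀ θ.b₁ Mstar, B9Thm312Whole.Ops (geo9Y x)
      (bg9YR (Matrix (Fin N) (Fin N) ℂ) (specialUnitaryUnits (Fin N)) R₁ R₂ x) (XBK (TrIdx N) x.toKIdx) (XBK (TrIdx N) x.toKIdx)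
      (XHK (TrIdx N) x.toKIdx) (XSK (TrIdx N) x.toKIdx)}
    (h𝔬12 : 𝔬12 = ops312YOfRecord N θ Mstar 𝔯 R₁ R₂ bI) :
    (∀ x : MemberY θ.d₆ θ.ℓ₆ θ.hd' θ.hL' θ.b₀ θ.b₁ Mstar, (𝔬12 x).blk = blkBK x.toKIdx (bI x)) ∧
    (∀ x : MemberY θ.d₆ θ.ℓ₆ θ.hd' θ.hL' θ.b₀ θ.b₁ Mstar, (𝔬12 x).blkW = blkSK x.toKIdx (sIK x.toKIdx (bI x))) ∧
    (∀ x : MemberY θ.d₆ θ.ℓ₆ θ.hd' θ.hL' θ.b₀ θ.b₁ Mstar, (𝔬12 x).blkY = blkBK x.toKIdx (bI x)) ∧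
    (∀ (x : MemberY θ.d₆ θ.ℓ₆ θ.hd' θ.hL' θ.b₀ θ.b₁ Mstar) (U : (bg9YR (Matrix (Fin N) (Fin N) ℂ) (specialUnitaryUnits (Fin N)) R₁ R₂ x).Cfg),
      (𝔬12 x).G0 U = GcoK x.toKIdx (trBasis N) (bg9YR (Matrix (Fin N) (Fin N) ℂ) (specialUnitaryUnits (Fin N)) R₁ R₂ x) (fun U => U)
        (lettersYOfRecordV4P N θ Mstar 𝔯 x).GA U) ∧
    (∀ (x : MemberY θ.d₆ θ.ℓ₆ θ.hd' θ.hL' θ.b₀ θ.b₁ Mstar) (U : (bg9YR (Matrix (Fin N) (Fin N) ℂ) (specialUnitaryUnits (Fin N)) R₁ R₂ x).Cfg),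
      (𝔬12 x).G U = GcoK x.toKIdx (trBasis N) (bg9YR (Matrix (Fin N) (Fin N) ℂ) (specialUnitaryUnits (Fin N)) R₁ R₂ x) (fun U => U)
        (lettersYOfRecordV4P N θ Mstar 𝔯 x).GD U) ∧
    (∀ (x : MemberY θ.d₆ θ.ℓ₆ θ.hd' θ.hL' θ.b₀ θ.b₁ Mstar) (U : (bg9YR (Matrix (Fin N) (Fin N) ℂ) (specialUnitaryUnits (Fin N)) R₁ R₂ x).Cfg),
      (𝔬12 x).G1 U = GcoK x.toKIdx (trBasis N) (bg9YR (Matrix (Fin N) (Fin N) ℂ) (specialUnitaryUnits (Fin N)) R₁ R₂ x) (fun U => U)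
        (lettersYOfRecordV4P N θ Mstar 𝔯 x).G₁ U) ∧
    (∀ (x : MemberY θ.d₆ θ.ℓ₆ θ.hd' θ.hL' θ.b₀ θ.b₁ Mstar) (U : (bg9YR (Matrix (Fin N) (Fin N) ℂ) (specialUnitaryUnits (Fin N)) R₁ R₂ x).Cfg),
      (𝔬12 x).GG U = GcoK x.toKIdx (trBasis N) (bg9YR (Matrix (Fin N) (Fin N) ℂ) (specialUnitaryUnits (Fin N)) R₁ R₂ x) (fun U => U)
        (lettersYOfRecordV4P N θ Mstar 𝔯 x).GG U) ∧
    (∀ (x : MemberY θ.d₆ θ.ℓ₆ θ.hd' θ.hL' θ.b₀ θ.b₁ Mstar) (U : (bg9YR (Matrix (Fin N) (Fin N) ℂ) (specialUnitaryUnits (Fin N)) R₁ R₂ x).Cfg),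
      (𝔬12 x).D U = DcoK x.toKIdx (trBasis N) (bg9YR (Matrix (Fin N) (Fin N) ℂ) (specialUnitaryUnits (Fin N)) R₁ R₂ x) (fun U => U) U) ∧
    (∀ (x : MemberY θ.d₆ θ.ℓ₆ θ.hd' θ.hL' θ.b₀ θ.b₁ Mstar) (U : (bg9YR (Matrix (Fin N) (Fin N) ℂ) (specialUnitaryUnits (Fin N)) R₁ R₂ x).Cfg),
      (𝔬12 x).Dstar U = DscoK x.toKIdx (trBasis N) (bg9YR (Matrix (Fin N) (Fin N) ℂ) (specialUnitaryUnits (Fin N)) R₁ R₂ x) (fun U => U) U) ∧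
    (∀ x : MemberY θ.d₆ θ.ℓ₆ θ.hd' θ.hL' θ.b₀ θ.b₁ Mstar, (𝔬12 x).blkZ = blkHK x.toKIdx) ∧
    (∀ (x : MemberY θ.d₆ θ.ℓ₆ θ.hd' θ.hL' θ.b₀ θ.b₁ Mstar) (U : (bg9YR (Matrix (Fin N) (Fin N) ℂ) (specialUnitaryUnits (Fin N)) R₁ R₂ x).Cfg),
      (𝔬12 x).Hm U = HcoK x.toKIdx (trBasis N) (bg9YR (Matrix (Fin N) (Fin N) ℂ) (specialUnitaryUnits (Fin N)) R₁ R₂ x) (fun U => U)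
        (lettersYOfRecordV4P N θ Mstar 𝔯 x).H U) ∧
    (∀ (x : MemberY θ.d₆ θ.ℓ₆ θ.hd' θ.hL' θ.b₀ θ.b₁ Mstar) (U : (bg9YR (Matrix (Fin N) (Fin N) ℂ) (specialUnitaryUnits (Fin N)) R₁ R₂ x).Cfg),
      (𝔬12 x).H1m U = HcoK x.toKIdx (trBasis N) (bg9YR (Matrix (Fin N) (Fin N) ℂ) (specialUnitaryUnits (Fin N)) R₁ R₂ x) (fun U => U)
        (lettersYOfRecordV4P N θ Mstar 𝔯 x).H₁ U) ∧
    (∀ (x : MemberY θ.d₆ θ.ℓ₆ θ.hd' θ.hL' θ.b₀ θ.b₁ Mstar) (U : (bg9YR (Matrix (Fin N) (Fin N) ℂ) (specialUnitaryUnits (Fin N)) R₁ R₂ x).Cfg),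
      (𝔬12 x).S0 U = S0coK x.toKIdx (trBasis N) (bg9YR (Matrix (Fin N) (Fin N) ℂ) (specialUnitaryUnits (Fin N)) R₁ R₂ x) (fun U => U)
        (parSymY x.toKIdx) (parBY x.toKIdx) (GpPhysY x.toKIdx (parSymY x.toKIdx)) U) ∧
    (∀ (x : MemberY θ.d₆ θ.ℓ₆ θ.hd' θ.hL' θ.b₀ θ.b₁ Mstar) (U : (bg9YR (Matrix (Fin N) (Fin N) ℂ) (specialUnitaryUnits (Fin N)) R₁ R₂ x).Cfg),
      (𝔬12 x).Tpi U = TpicoK x.toKIdx (trBasis N) (bg9YR (Matrix (Fin N) (Fin N) ℂ) (specialUnitaryUnits (Fin N)) R₁ R₂ x) (fun U => U)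
        (parSymY x.toKIdx) (GpPhysY x.toKIdx (parSymY x.toKIdx)) U) ∧
    (∀ (x : MemberY θ.d₆ θ.ℓ₆ θ.hd' θ.hL' θ.b₀ θ.b₁ Mstar) (U : (bg9YR (Matrix (Fin N) (Fin N) ℂ) (specialUnitaryUnits (Fin N)) R₁ R₂ x).Cfg),
      (𝔬12 x).T2 U = T2coK x.toKIdx (trBasis N) (bg9YR (Matrix (Fin N) (Fin N) ℂ) (specialUnitaryUnits (Fin N)) R₁ R₂ x) (fun U => U)
        (parSymY x.toKIdx) (GpPhysY x.toKIdx (parSymY x.toKIdx)) (𝔯 x).Δ2 U) ∧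
    (∀ (x : MemberY θ.d₆ θ.ℓ₆ θ.hd' θ.hL' θ.b₀ θ.b₁ Mstar) (U : (bg9YR (Matrix (Fin N) (Fin N) ℂ) (specialUnitaryUnits (Fin N)) R₁ R₂ x).Cfg),
      (𝔬12 x).Q U = QcoKH x.toKIdx (trBasis N) (bg9YR (Matrix (Fin N) (Fin N) ℂ) (specialUnitaryUnits (Fin N)) R₁ R₂ x) (fun U => U)
        (parBY x.toKIdx) U) ∧
    (∀ (x : MemberY θ.d₆ θ.ℓ₆ θ.hd' θ.hL' θ.b₀ θ.b₁ Mstar) (U : (bg9YR (Matrix (Fin N) (Fin N) ℂ) (specialUnitaryUnits (Fin N)) R₁ R₂ x).Cfg),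
      (𝔬12 x).Qstar U = QscoKH x.toKIdx (trBasis N) (bg9YR (Matrix (Fin N) (Fin N) ℂ) (specialUnitaryUnits (Fin N)) R₁ R₂ x) (fun U => U)
        (parBY x.toKIdx) U) ∧
    (∀ (x : MemberY θ.d₆ θ.ℓ₆ θ.hd' θ.hL' θ.b₀ θ.b₁ Mstar) (U : (bg9YR (Matrix (Fin N) (Fin N) ℂ) (specialUnitaryUnits (Fin N)) R₁ R₂ x).Cfg),
      (𝔬12 x).C U = CcoK x.toKIdx (trBasis N) (bg9YR (Matrix (Fin N) (Fin N) ℂ) (specialUnitaryUnits (Fin N)) R₁ R₂ x) (fun U => U)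
        (parSymY x.toKIdx) (parBY x.toKIdx) (GpPhysY x.toKIdx (parSymY x.toKIdx)) U) ∧
    (∀ (x : MemberY θ.d₆ θ.ℓ₆ θ.hd' θ.hL' θ.b₀ θ.b₁ Mstar) (U : (bg9YR (Matrix (Fin N) (Fin N) ℂ) (specialUnitaryUnits (Fin N)) R₁ R₂ x).Cfg),
      (𝔬12 x).C1 U = C1coK x.toKIdx (trBasis N) (bg9YR (Matrix (Fin N) (Fin N) ℂ) (specialUnitaryUnits (Fin N)) R₁ R₂ x) (fun U => U)
        (parSymY x.toKIdx) (parBY x.toKIdx) (GpPhysY x.toKIdx (parSymY x.toKIdx)) (𝔯 x).Δ2 U) ∧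
    (∀ (x : MemberY θ.d₆ θ.ℓ₆ θ.hd' θ.hL' θ.b₀ θ.b₁ Mstar) (U : (bg9YR (Matrix (Fin N) (Fin N) ℂ) (specialUnitaryUnits (Fin N)) R₁ R₂ x).Cfg),
      (𝔬12 x).Dv U = DvcoKH x.toKIdx (trBasis N) (bg9YR (Matrix (Fin N) (Fin N) ℂ) (specialUnitaryUnits (Fin N)) R₁ R₂ x) (fun U => U) U) ∧
    (∀ (x : MemberY θ.d₆ θ.ℓ₆ θ.hd' θ.hL' θ.b₀ θ.b₁ Mstar) (U : (bg9YR (Matrix (Fin N) (Fin N) ℂ) (specialUnitaryUnits (Fin N)) R₁ R₂ x).Cfg),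
      (𝔬12 x).Dvstar U = DvscoKH x.toKIdx (trBasis N) (bg9YR (Matrix (Fin N) (Fin N) ℂ) (specialUnitaryUnits (Fin N)) R₁ R₂ x) (fun U => U) U) ∧
    (∀ (x : MemberY θ.d₆ θ.ℓ₆ θ.hd' θ.hL' θ.b₀ θ.b₁ Mstar) (U : (bg9YR (Matrix (Fin N) (Fin N) ℂ) (specialUnitaryUnits (Fin N)) R₁ R₂ x).Cfg),
      (𝔬12 x).R U = RcoK x.toKIdx (trBasis N) (bg9YR (Matrix (Fin N) (Fin N) ℂ) (specialUnitaryUnits (Fin N)) R₁ R₂ x) (fun U => U)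
        (parSymY x.toKIdx) (GpPhysY x.toKIdx (parSymY x.toKIdx)) U) := by
  subst h𝔬12
  exact ⟨ops312YOfRecord_blk N θ Mstar 𝔯 R₁ R₂ bI, ops312YOfRecord_blkW N θ Mstar 𝔯 R₁ R₂ bI, ops312YOfRecord_blkY N θ Mstar 𝔯 R₁ R₂ bI,
    ops312YOfRecord_G0 N θ Mstar 𝔯 R₁ R₂ bI, ops312YOfRecord_G N θ Mstar 𝔯 R₁ R₂ bI, ops312YOfRecord_G1 N θ Mstar 𝔯 R₁ R₂ bI,
    ops312YOfRecord_GG N θ Mstar 𝔯 R₁ R₂ bI, ops312YOfRecord_D N θ Mstar 𝔯 R₁ R₂ bI, ops312YOfRecord_Dstar N θ Mstar 𝔯 R₁ R₂ bI,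
    ops312YOfRecord_blkZ N θ Mstar 𝔯 R₁ R₂ bI, ops312YOfRecord_Hm N θ Mstar 𝔯 R₁ R₂ bI, ops312YOfRecord_H1m N θ Mstar 𝔯 R₁ R₂ bI,
    ops312YOfRecord_S0 N θ Mstar 𝔯 R₁ R₂ bI, ops312YOfRecord_Tpi N θ Mstar 𝔯 R₁ R₂ bI, ops312YOfRecord_T2 N θ Mstar 𝔯 R₁ R₂ bI,
    ops312YOfRecord_Q N θ Mstar 𝔯 R₁ R₂ bI, ops312YOfRecord_Qstar N θ Mstar 𝔯 R₁ R₂ bI, ops312YOfRecord_C N θ Mstar 𝔯 R₁ R₂ bI,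
    ops312YOfRecord_C1 N θ Mstar 𝔯 R₁ R₂ bI, ops312YOfRecord_Dv N θ Mstar 𝔯 R₁ R₂ bI, ops312YOfRecord_Dvstar N θ Mstar 𝔯 R₁ R₂ bI,
    ops312YOfRecord_R N θ Mstar 𝔯 R₁ R₂ bI⟩

end Pins

end Literature.MathematicalPhysics.QuantumFieldTheory.Balaban1983to89.Node00.OpsYOps312OfRecord
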